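import Summits.NavierStokesRegularity.NavierStokesRegularity.Theorems.QuantisedSymmetryPolyhedralDssProfileExistsCellOfProfile
import Summits.NavierStokesRegularity.NavierStokesRegularity.Theorems.QuantisedSymmetryPolyhedralDssProfileExistsDominatesBlowupProfile
import Summits.NavierStokesRegularity.NavierStokesRegularity.Theorems.QuantisedSymmetryPolyhedralDssProfileExistsNoSmallCell

/-!
# Strategist sketch S18 — independent strategy census (family `s`, seat s18) for the crux
# `QuantisedSymmetry.PolyhedralDssProfileExists` (X⁻, stmt-NavierStokesRegularity-1404)

Companion to `STRATEGY-CENSUS-s18.md`. Every statement below is TYPED over existing declarations and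
the file elaborates with NO `sorry`; the theorems are the cheap logical edges the census relies on.
Nothing here is a registered line: the census verdict is `no-strategy-short-of-summit`, and this file
records the typed objects that verdict was tested against —

* §1 WEAKER INTERMEDIATE: the ladder `crux → W₁ → W` with `W₁ := ∃ λ > 1, ¬ TypeIDSSLiouville λ`
  (drop the symmetry group) and `W := Blowup.BlowupTypeIDssProfile` (stmt-0155; drop also `R = 1`),
  both edges proved (`crux_implies_W₁`, `W₁_implies_W`; tree `stub_dominatesBlowupProfile`).
* §2 STRENGTHEN: `IsolatedProfileExists` (a witness that is locally unique modulo the residual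
  scaling symmetry — the rigidity a Newton–Kantorovich / continuation argument would need) and
  `SelfSimilarPolyhedralProfileExists` (DSS at every factor: refuted in print, NRŠ 1996 / Tsai 1998);
  `crux_of_isolated` is the trivial edge.
* §3 DECOMPOSITION: the cell form `CellForm` (tree: `↔ crux`, `cellForm_iff_crux`), the approximation
  piece `ApproximableCell` (P1: open `G`-cells with closing defect `≤ δ` for every `δ > 0`, a uniform
  Type-I space–time envelope and a fixed-ball energy floor) and the closure piece `CellClosure`
  (P2 := P1 → CellForm, a parabolic-compactness lemma); `crux_of_split : P1 → P2 → crux` is proved.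
  The census explains why this split has no teeth (P1 ↔ crux given P2).
-/

noncomputable section

namespace Summit.NavierStokesRegularity.NavierStokesRegularity.Cruxes.PolyhedralDssProfileExists.S18

open MeasureTheory Set Function
open Literature.Analysis.FluidPDE
open Summit.NavierStokesRegularity.NavierStokesRegularity.Theses
open Summit.NavierStokesRegularity.NavierStokesRegularity.Theorems.PolyhedralDssProfileExists

set_option linter.unusedVariables false
set_option linter.dupNamespace false

/-- `ℝ³` as used by the route. -/
abbrev E3 : Type := EuclideanSpace ℝ (Fin 3)

/-- The symmetry clause of the crux: `G` is a finite group of rotations of `ℝ³` acting irreducibly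
(a "polyhedral" group: up to conjugacy the rotation group of the tetrahedron, the octahedron or the
icosahedron — cyclic and dihedral groups leave an axis invariant). -/
def IsPolyhedralGroup (G : Subgroup (E3 ≃ₗᵢ[ℝ] E3)) : Prop :=
  Finite G ∧ (∀ g ∈ G, LinearMap.det (g.toLinearEquiv : E3 →ₗ[ℝ] E3) = 1) ∧
    (∀ V : Submodule ℝ E3, (∀ g ∈ G, ∀ v ∈ V, g v ∈ V) → V = ⊥ ∨ V = ⊤)

/-- The analytic clause of the crux for a fixed group `G` and factor `c`: `u` is a `G`-equivariant,
Type-I, `c`-DSS, not a.e.-trivial ancient mild solution with measurable slices. -/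
def IsProfile (G : Subgroup (E3 ≃ₗᵢ[ℝ] E3)) (c : ℝ) (u : ℝ → E3 → E3) : Prop :=
  IsAncientMildSolution 1 u ∧ (∀ t < 0, AEStronglyMeasurable (u t) volume) ∧
    IsDiscretelySelfSimilar c u ∧ (∃ C₀ : ℝ, HasTypeIDecay C₀ u) ∧
    (∀ g ∈ G, ∀ t x, u t (g x) = g (u t x)) ∧ ¬ (∀ t < 0, u t =ᵐ[volume] 0)

/-- The crux, re-assembled from the two clauses (definitionally the route decl). -/
theorem crux_iff_profile :
    QuantisedSymmetry.PolyhedralDssProfileExists ↔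
      ∃ G : Subgroup (E3 ≃ₗᵢ[ℝ] E3), IsPolyhedralGroup G ∧ ∃ c : ℝ, 1 < c ∧ ∃ u, IsProfile G c u := by
  constructor
  · rintro ⟨G, hfin, hdet, hirr, c, hc, u, h1, h2, h3, h4, h5, h6⟩
    exact ⟨G, ⟨hfin, hdet, hirr⟩, c, hc, u, ⟨h1, h2, h3, h4, h5, h6⟩⟩
  · rintro ⟨G, ⟨hfin, hdet, hirr⟩, c, hc, u, ⟨h1, h2, h3, h4, h5, h6⟩⟩
    exact ⟨G, hfin, hdet, hirr, c, hc, u, h1, h2, h3, h4, h5, h6⟩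

/-! ## §1 Weaker intermediates (the instruction's first move) -/

/-- `W₁`: SOME Type-I `λ`-DSS Liouville statement fails — the crux with the symmetry group dropped. -/
def W₁ : Prop := ∃ c : ℝ, 1 < c ∧ ¬ TypeIDSSLiouville c

/-- `crux → W₁` (tree: `exists_not_typeIDSSLiouville_of_polyhedralDssProfileExists`). -/
theorem crux_implies_W₁ : QuantisedSymmetry.PolyhedralDssProfileExists → W₁ :=
  PolyhedralCell.exists_not_typeIDSSLiouville_of_polyhedralDssProfileExists

/-- `W₁ → W` with `W := Blowup.BlowupTypeIDssProfile` (stmt-0155: the rotated form, `R` free). -/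
theorem W₁_implies_W : W₁ → Blowup.BlowupTypeIDssProfile := by
  rintro ⟨c, -, hc⟩
  dsimp only [Blowup.BlowupTypeIDssProfile]
  exact fun hL => hc (hL c).1

/-- `crux → W` (tree: `stub_dominatesBlowupProfile`, p156644). -/
theorem crux_implies_W : QuantisedSymmetry.PolyhedralDssProfileExists → Blowup.BlowupTypeIDssProfile :=
  PolyhedralCell.stub_dominatesBlowupProfile

/-! ## §2 Strengthenings -/

/-- `S⁺`: an ISOLATED polyhedral profile — a witness `u` which is locally unique, in the scale-invariant
norm `sup √(-t)|·|`, among profiles with the same `(G, λ)`, modulo the residual symmetry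
`u ↦ μ u(μ²·, μ·)` (`μ > 0`). This is the rigidity a Newton–Kantorovich certification or a continuation
argument needs (invertible linearised period map ⇒ isolated modulo symmetries). -/
def IsolatedProfileExists : Prop :=
  ∃ G : Subgroup (E3 ≃ₗᵢ[ℝ] E3), IsPolyhedralGroup G ∧ ∃ c : ℝ, 1 < c ∧ ∃ u, IsProfile G c u ∧
    ∃ δ : ℝ, 0 < δ ∧ ∀ u', IsProfile G c u' →
      (∀ t < 0, ∀ x, Real.sqrt (-t) * ‖u' t x - u t x‖ ≤ δ) →
        ∃ μ : ℝ, 0 < μ ∧ ∀ t x, u' t x = μ • u (μ ^ 2 * t) (μ • x)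

/-- The trivial edge `S⁺ → crux`. -/
theorem crux_of_isolated : IsolatedProfileExists → QuantisedSymmetry.PolyhedralDssProfileExists := by
  rintro ⟨G, hG, c, hc, u, hu, -⟩
  exact crux_iff_profile.2 ⟨G, hG, c, hc, u, hu⟩

/-- `S⁺⁺`: a polyhedral profile which is DSS at EVERY factor, i.e. self-similar. Refuted in print
(Nečas–Růžička–Šverák 1996; Tsai 1998 Thm 1, tree `tsai_selfsimilar_holds`; in the crux's own variables
`Lines/birth.lean: steadyLerayProfile_eq_zero_of_typeI`): recorded as the dead end of "strengthen the
scaling symmetry". -/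
def SelfSimilarPolyhedralProfileExists : Prop :=
  ∃ G : Subgroup (E3 ≃ₗᵢ[ℝ] E3), IsPolyhedralGroup G ∧ ∃ u : ℝ → E3 → E3,
    (∀ c : ℝ, 1 < c → IsProfile G c u)

/-- `S⁺⁺ → crux` (any factor, e.g. `λ = 2`). -/
theorem crux_of_selfSimilar :
    SelfSimilarPolyhedralProfileExists → QuantisedSymmetry.PolyhedralDssProfileExists := by
  rintro ⟨G, hG, u, hu⟩
  exact crux_iff_profile.2 ⟨G, hG, 2, one_lt_two, u, hu 2 one_lt_two⟩

/-! ## §3 Decomposition: approximation piece + closure piece -/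

/-- An OPEN `G`-cell on the model slab `[-1, -c⁻²]`: every clause of the line's cell
(`PolyhedralCell.PolyhedralCellExists`) except the closing condition `v(-c⁻²) = c • v(-1)(c·)`. -/
def IsOpenCell (G : Subgroup (E3 ≃ₗᵢ[ℝ] E3)) (c : ℝ) (v : ℝ → E3 → E3) : Prop :=
  ContinuousOn (Function.uncurry v) (Set.Icc (-1 : ℝ) (-(c ^ 2)⁻¹) ×ˢ Set.univ) ∧
    (∃ M : ℝ, ∀ t ∈ Set.Icc (-1 : ℝ) (-(c ^ 2)⁻¹), ∀ x, ‖v t x‖ ≤ M) ∧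
    (∀ t ∈ Set.Icc (-1 : ℝ) (-(c ^ 2)⁻¹), IsWeaklyDivFree (v t)) ∧
    (∀ s t : ℝ, -1 ≤ s → s < t → t ≤ -(c ^ 2)⁻¹ → ∀ x,
      v t x = heatFlow (v s) (t - s) x - oseenDuhamel 1 s v v t x) ∧
    (∀ g ∈ G, ∀ t ∈ Set.Icc (-1 : ℝ) (-(c ^ 2)⁻¹), ∀ x, v t (g x) = g (v t x))

/-- Closing defect at most `δ`: the junction mismatch `v(-c⁻²) - c • v(-1)(c·)` is uniformly `≤ δ`. -/
def ClosingDefectLe (c δ : ℝ) (v : ℝ → E3 → E3) : Prop :=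
  ∀ x, ‖v (-(c ^ 2)⁻¹) x - c • v (-1) (c • x)‖ ≤ δ

/-- Zero defect is the closing condition. -/
theorem closingDefectLe_zero_iff (c : ℝ) (v : ℝ → E3 → E3) :
    ClosingDefectLe c 0 v ↔ ∀ x, v (-(c ^ 2)⁻¹) x = c • v (-1) (c • x) :=
  forall_congr' fun x => by rw [norm_le_zero_iff, sub_eq_zero]

/-- The crux in CELL FORM: a polyhedral group, a factor, an open cell with zero closing defect and a
nontrivial `L⁴` datum. -/
def CellForm : Prop :=
  ∃ G : Subgroup (E3 ≃ₗᵢ[ℝ] E3), IsPolyhedralGroup G ∧ ∃ c : ℝ, 1 < c ∧ ∃ v : ℝ → E3 → E3,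
    IsOpenCell G c v ∧ ClosingDefectLe c 0 v ∧ MemLp (v (-1)) 4 volume ∧ ¬ (v (-1) =ᵐ[volume] 0)

/-- `CellForm ↔ crux` (tree: `polyhedralDssProfileExists_iff_cell`, p156679 + p152884). -/
theorem cellForm_iff_crux : CellForm ↔ QuantisedSymmetry.PolyhedralDssProfileExists := by
  rw [PolyhedralCell.polyhedralDssProfileExists_iff_cell]
  constructor
  · rintro ⟨G, ⟨hfin, hdet, hirr⟩, c, hc, v, ⟨hcont, hbd, hdiv, hmild, heqv⟩, hclose, hL4, hnt⟩
    exact ⟨G, hfin, hdet, hirr, c, hc, v,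
      ⟨hcont, hbd, hdiv, hmild, (closingDefectLe_zero_iff c v).1 hclose, heqv⟩, hL4, hnt⟩
  · rintro ⟨G, hfin, hdet, hirr, c, hc, v, ⟨hcont, hbd, hdiv, hmild, hclose, heqv⟩, hL4, hnt⟩
    exact ⟨G, ⟨hfin, hdet, hirr⟩, c, hc, v, ⟨hcont, hbd, hdiv, hmild, heqv⟩,
      (closingDefectLe_zero_iff c v).2 hclose, hL4, hnt⟩

/-- **P1 (approximation piece).** For some polyhedral `G`, factor `c > 1`, envelope constant `C₀`,
floor `η > 0` and radius `R > 0`: for every `δ > 0` there is an open `G`-cell with closing defect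
`≤ δ`, the Type-I space–time envelope `|v(t,x)| ≤ C₀/(|x| + √(-t))` on the slab, an `L⁴` datum, and
local energy at least `η` on the fixed ball `B_R` at time `-1` (the floor that survives locally uniform
limits; without it the limit may be the trivial cell, cf. `stub_noSmallCell`). -/
def ApproximableCell : Prop :=
  ∃ G : Subgroup (E3 ≃ₗᵢ[ℝ] E3), IsPolyhedralGroup G ∧ ∃ c : ℝ, 1 < c ∧ ∃ C₀ η R : ℝ, 0 < η ∧ 0 < R ∧
    ∀ δ : ℝ, 0 < δ → ∃ v : ℝ → E3 → E3, IsOpenCell G c v ∧ ClosingDefectLe c δ v ∧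
      (∀ t ∈ Set.Icc (-1 : ℝ) (-(c ^ 2)⁻¹), ∀ x, ‖v t x‖ ≤ C₀ / (‖x‖ + Real.sqrt (-t))) ∧
      MemLp (v (-1)) 4 volume ∧
      η ≤ ∫ x in Metric.ball (0 : E3) R, ‖v (-1) x‖ ^ 2

/-- **P2 (closure piece).** Approximable ⇒ exact: a parabolic-compactness lemma (uniform envelope ⇒
interior smoothness and local compactness of open cells; Oseen-mildness, weak solenoidality,
equivariance and the envelope pass to locally uniform limits; defect `→ 0` gives the closing
condition; the fixed-ball floor gives nontriviality). Routine (M-sized) — and exactly why the split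
has no teeth: given P2, P1 is equivalent to the crux. -/
def CellClosure : Prop := ApproximableCell → CellForm

/-- The split's assembly `P1 → P2 → crux` (modus ponens through `cellForm_iff_crux`). -/
theorem crux_of_split (h₁ : ApproximableCell) (h₂ : CellClosure) :
    QuantisedSymmetry.PolyhedralDssProfileExists :=
  cellForm_iff_crux.1 (h₂ h₁)

/-- The floor is forced: by the tree's `stub_noSmallCell` there is an absolute `ε₀ > 0` such that
every exact cell with `sup √(-t)|v| ≤ ε₀` on the model slab is trivial — so approximating families
cannot be sought near `0` (no bifurcation from the trivial solution in any space). -/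
theorem noSmallCell_floor :
    ∃ ε₀ : ℝ, 0 < ε₀ ∧
      ∀ (G : Subgroup (E3 ≃ₗᵢ[ℝ] E3)) (c : ℝ), 1 < c → ∀ v : ℝ → E3 → E3,
        IsOpenCell G c v → ClosingDefectLe c 0 v → MemLp (v (-1)) 4 volume →
        (∀ t ∈ Set.Icc (-1 : ℝ) (-(c ^ 2)⁻¹), ∀ x, Real.sqrt (-t) * ‖v t x‖ ≤ ε₀) → v (-1) = 0 := by
  obtain ⟨ε₀, hε₀, h⟩ := PolyhedralCell.stub_noSmallCell
  refine ⟨ε₀, hε₀, fun G c hc v hopen hclose hL4 hsmall => ?_⟩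
  obtain ⟨hcont, hbd, hdiv, hmild, heqv⟩ := hopen
  exact h G c hc v ⟨hcont, hbd, hdiv, hmild, (closingDefectLe_zero_iff c v).1 hclose, heqv⟩ hL4 hsmall

end Summit.NavierStokesRegularity.NavierStokesRegularity.Cruxes.PolyhedralDssProfileExists.S18

end
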